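/-
Copyright (c) 2026 the pub-hodgecm-mathlib formalisation cell (harness21).  Prover seat hodgecm-mathlib-F0P3-p02 (g18): line LH3 (closer stub `stub_N9`), organ J,
brick (J-G′-BLOCK-ν) «the two eventual binders of ★ (J-G′-BLOCK) along the wall normal, hypothesis-free» (offer 2026-09-02T08:53Z on the LH3 bus).
-/
import Literature.NumberTheory.Rogawski1990.ArchInnerFormChartOrbIntegrable    -- ★ p850356∕p850485 (F0P3a-p08 (g22)): `integrable_descConj_gprimeTorus_of_regG`; brings ★ p850470 SPLIT-DOCK (`uniformlyProper_gprimeTorus_of_semireg_of_regular`), ★ D4b-1, ★ (T-MEAS-G′)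
import Literature.NumberTheory.Rogawski1990.ArchCartanWallExtensionGDocks    -- ★ p850260∕p850265 (LH3-p02 (g2)): `eventually_add_smul_hcNrm_mem_regG`, `tendsto_add_smul_hcNrm`; brings ★ p850239 `exists_nhds_hcSemireg`, ★ `ArchHCSpaceG` (`hcNrm`, `HcSemireg`)
import HarnessLib

/-!
# (J-G′-BLOCK-ν): the two eventual binders of ★ (J-G′-BLOCK) along the wall normal — ONE compact `C″` modulo `Z(γ_p)` near the semiregular point, integrability off the wall
# (Rogawski 1990 §4.12 Lemma 4.12.1, §8.2; Harish-Chandra–van Dijk 1970 Part I §3 Lemma 22; Shelstad 1979 §4)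

Topic `NumberTheory/Rogawski1990`; namespace `Literature.NumberTheory.Rogawski1990`.  THEOREMS ONLY (no `def`, no instance, no notation, no axiom, no named fact, no `sorry`);
kernel lane `--kind proof --supports stmt-HodgeConjecture-24833`.  Cell `pub/hodgecm-mathlib`, crux H413 (`stmt-HodgeConjecture-24833`), F0∕P3c line LH3 (closer stub `stub_N9`,
DIRECT ROAD `F0_P3c_StubN9Direct`, organ J, residual stub `stub_N9jumpGSide`), brick **(J-G′-BLOCK-ν)** (seat F0P3-p02 (g18)): the two EVENTUAL hypotheses of ★ (J-G′-BLOCK)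
`exists_block_testFunction_chartOrbG_eventuallyEq` ∕ `chartOrbG_add_smul_hcNrm_eventuallyEq_descended_of_cutoff` (p850417, this seat) along the normal `c_ν = p + ν • hcNrm w₀ 0 2`
of a SEMIREGULAR compact-wall point `p` (`w₀ ∉ S`, `S` admissible), DISCHARGED hypothesis-free:
* `hCMν` — ONE compact `C″ ⊆ G′_∞` with `y′ · gprimeTorus c_ν · y′⁻¹ ∈ C′ ⇒ y′ ∈ C″ · Z(gprimeTorus p)` for all small `ν` (INCLUDING `ν = 0`): Harish-Chandra's compactness lemma ★ D4b-1
  through ★ SPLIT-DOCK's `uniformlyProper_gprimeTorus_of_semireg_of_regular` (p850470, F0P3a-p08 (g22)) on a compact normal SEGMENT inside the semiregular neighbourhood of ★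
  `exists_nhds_hcSemireg` (p850239, F0P3a-p09 (g5)), lifted to the group (★ `exists_isCompact_image_mk_superset`);
* `hintν` — the chart integrand at `c_ν` is integrable for small `ν ≠ 0`: the normal runs in `RegG S` off the wall (★ docks `eventually_add_smul_hcNrm_mem_regG`, p850260) and ★
  `integrable_descConj_gprimeTorus_of_regG` (p850485) at regular points of admissible charts.
The consumer (LH3-p02 (g3), (G′-SIDE) piece (c)) then chooses ONE cut-off `β` of unit `Z(γ_p)`-mass on `(C″_S ∪ C″_{insert w₀ S}) · Z(γ_p)` (★
`exists_continuous_hasCompactSupport_integral_comp_mul_eq_one`) and feeds ★ p850417 — no binder of the (J-G′-JUMP) chain is left undischarged on the compact-chart side.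

* §1 `normalSegment_subset_of_mem_nhds` (a compact normal segment inside any neighbourhood of `p`), **`exists_isCompact_mul_centralizer_nhds_hcSemireg`** (`hCMν` on `𝓝 0`, any compact `C′`);
* §2 **`eventually_integrable_descConj_add_smul_hcNrm`** (`hintν`);
* §3 **`exists_blockNormal_binders`** — both at once with `C′ := tsupport a′`, on `𝓝[≠] 0`, in ★ p850417's binder spelling.
HONEST LABEL: HC_CM is proved only modulo the 7 printed citations (2 remaining named inputs: hLiu418 = `stmt-HodgeConjecture-24832`, h413 = `stmt-HodgeConjecture-24833`) until rung 0
closes; count-neutral topology under organ J of `stub_N9` (no stub closes by this file alone).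

## References
* [Rogawski1990] J. D. Rogawski, *Automorphic Representations of Unitary Groups in Three Variables*, Ann. of Math. Stud. 123 (1990), §4.12 Lemma 4.12.1 p. 66 (the compactness
  lemma, ONE `φ` for all `x` near `1`), §8.2 pp. 114, 122–124 (orbital integrals near the walls of `U(2,1)`).
* [HarishChandra1970] Harish-Chandra (notes by G. van Dijk), *Harmonic Analysis on Reductive p-adic Groups*, LNM 162 (1970), Part I §3 Lemma 22.
* [Shelstad1979] D. Shelstad, *Characters and inner forms of a quasi-split group over ℝ*, Compositio Math. 39 (1979), §4 pp. 22–25 (semiregular points, the normal to a wall).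
* [DeitmarEchterhoff2014] A. Deitmar, S. Echterhoff, *Principles of Harmonic Analysis*, 2nd ed. (2014), Lemma 9.3.3, Remark 1.5.2.
-/

set_option autoImplicit false

noncomputable section

open MeasureTheory MeasureTheory.Measure Set Filter Topology NumberField NumberField.InfinitePlace
open Literature.MeasureTheory.Group Literature.NumberTheory.Automorphic Literature.NumberTheory.Automorphic.UnitaryGroup Literature.NumberTheory.Automorphic.ArchCartan
open scoped MatrixGroups Matrix Pointwise Classical

namespace Literature.NumberTheory.Rogawski1990

section Binders

variable (L : Type) [Field L] [NumberField L] [IsCMField L] (α : Fin 3 → L)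
  (S : Finset {w : InfinitePlace L // IsComplex w}) (w₀ : {w : InfinitePlace L // IsComplex w}) (p : {w : InfinitePlace L // IsComplex w} → Fin 3 → ℝ)

/-! ## §1 One compact modulo `Z(γ_p)` for the whole normal segment -/

omit [NumberField L] [IsCMField L] in
/-- A compact normal segment `{p + ν • hcNrm w₀ 0 2 : |ν| ≤ ε}` inside any neighbourhood of `p`, with `[−ε, ε] ∈ 𝓝 0`. [cite: Shelstad1979, §4 p. 25] -/
theorem normalSegment_subset_of_mem_nhds {U : Set ({w : InfinitePlace L // IsComplex w} → Fin 3 → ℝ)} (hU : U ∈ 𝓝 p) :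
    ∃ ε : ℝ, 0 < ε ∧ (fun ν : ℝ => p + ν • hcNrm w₀ 0 2) '' Set.Icc (-ε) ε ⊆ U := by
  have hmem : ∀ᶠ ν : ℝ in 𝓝 0, p + ν • hcNrm w₀ 0 2 ∈ U := tendsto_add_smul_hcNrm p w₀ 0 2 hU
  obtain ⟨ε, hε, hball⟩ := Metric.eventually_nhds_iff_ball.1 hmem
  refine ⟨ε / 2, half_pos hε, ?_⟩
  rintro _ ⟨ν, hν, rfl⟩
  refine hball ν ?_
  rw [Metric.mem_ball, dist_zero_right, Real.norm_eq_abs, abs_lt]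
  constructor <;> linarith [hν.1, hν.2]

/-- **`hCMν` — HARISH-CHANDRA'S COMPACTNESS LEMMA ALONG THE NORMAL, hypothesis-free**: at a semiregular point `p` of the compact wall `(w₀, 0, 2)` of an admissible chart `S`
(`w₀ ∉ S`), for every compact `C′ ⊆ G′_∞` there is ONE compact `C″` with `y′ · gprimeTorus (p + ν • hcNrm w₀ 0 2) · y′⁻¹ ∈ C′ ⇒ y′ ∈ C″ · Z(gprimeTorus p)` for all `ν` near `0`
(★ SPLIT-DOCK `uniformlyProper_gprimeTorus_of_semireg_of_regular` on a compact normal segment inside ★ `exists_nhds_hcSemireg`'s neighbourhood; slot `1` is the simple one).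
[cite: Rogawski1990, §4.12 Lemma 4.12.1 p. 66; §8.2 p. 114] [cite: HarishChandra1970, Part I §3 Lemma 22] [cite: Shelstad1979, §4 p. 22] [cite: DeitmarEchterhoff2014, Remark 1.5.2] -/
theorem exists_isCompact_mul_centralizer_nhds_hcSemireg (hα : ∀ i, α i ≠ 0)
    (hreal : ∀ (w : {w : InfinitePlace L // IsComplex w}) (i : Fin 3), (w.1.embedding (α i)).im = 0)
    (hS : ∀ w, w ∈ S → w ∈ splitChartPlaces L α) (hw₀ : w₀ ∉ S) (hp : HcSemireg S w₀ 0 2 p)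
    {C' : Set ↥(arch (↥(maximalRealSubfield L)) L (IsCMField.complexConj L) 3 (Matrix.diagonal α))} (hC' : IsCompact C') :
    ∃ C'' : Set ↥(arch (↥(maximalRealSubfield L)) L (IsCMField.complexConj L) 3 (Matrix.diagonal α)), IsCompact C'' ∧
      ∀ᶠ ν in 𝓝 (0 : ℝ), ∀ y' : ↥(arch (↥(maximalRealSubfield L)) L (IsCMField.complexConj L) 3 (Matrix.diagonal α)),
        y' * gprimeTorus L α S (p + ν • hcNrm w₀ 0 2) * y'⁻¹ ∈ C' →
          y' ∈ C'' * ((Subgroup.centralizer ({gprimeTorus L α S p} : Set ↥(arch (↥(maximalRealSubfield L)) L (IsCMField.complexConj L) 3 (Matrix.diagonal α)))) :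
            Set ↥(arch (↥(maximalRealSubfield L)) L (IsCMField.complexConj L) 3 (Matrix.diagonal α))) := by
  have h02 : (0 : Fin 3) ≠ 2 := by decide
  obtain ⟨U, hUo, hpU, -, -, hU2, hU3, hU4⟩ := exists_nhds_hcSemireg hw₀ h02 hp
  obtain ⟨ε, hε, hKU⟩ := normalSegment_subset_of_mem_nhds L w₀ p (hUo.mem_nhds hpU)
  -- the compact normal segment
  have hKc : IsCompact ((fun ν : ℝ => p + ν • hcNrm w₀ 0 2) '' Set.Icc (-ε) ε) :=
    isCompact_Icc.image (continuous_const.add (continuous_id.smul continuous_const))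
  -- the place sets: slot `1` simple at `w₀`, regular elsewhere, `x ≠ 0` at the split places
  have hKS : (fun ν : ℝ => p + ν • hcNrm w₀ 0 2) '' Set.Icc (-ε) ε ⊆ Set.pi Set.univ
      (fun w : {w : InfinitePlace L // IsComplex w} => {cw : Fin 3 → ℝ |
        (w = w₀ → ∀ j : Fin 3, j ≠ 1 → Circle.exp (cw 1) ≠ Circle.exp (cw j)) ∧
        (w ∉ S → w ≠ w₀ → Function.Injective fun l : Fin 3 => Circle.exp (cw l)) ∧ (w ∈ S → cw 0 ≠ 0)}) := by
    intro c hc w _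
    have hcU : c ∈ U := hKU hc
    refine ⟨fun hw j hj => ?_, fun hwS hww => hU3 c hcU w hwS hww, fun hwS => hU4 c hcU w hwS⟩
    rw [hw]
    have h1 := hU2 c hcU 1 (by decide) (by decide)
    fin_cases j
    · exact h1.1
    · exact absurd rfl hj
    · exact h1.2
  have hkey : ∀ j : Fin 3, j ≠ 1 → Circle.exp (p w₀ j) = Circle.exp (p w₀ 0) := by
    intro j hj
    fin_cases j
    · rfl
    · exact absurd rfl hj
    · exact congrArg Circle.exp hp.1.symm
  have hwall : ∀ j j' : Fin 3, j ≠ 1 → j' ≠ 1 → Circle.exp (p w₀ j) = Circle.exp (p w₀ j') :=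
    fun j j' hj hj' => (hkey j hj).trans (hkey j' hj').symm
  have hw₀' : ¬ (w₀ ∈ S ∧ w₀ ∈ splitChartPlaces L α) := fun h => hw₀ h.1
  have hpS : ∀ w, w ∈ S ∧ w ∈ splitChartPlaces L α → p w 0 ≠ 0 := fun w hw => hp.2.2.2 w hw.1
  obtain ⟨𝒦', h𝒦', hmem𝒦⟩ := uniformlyProper_gprimeTorus_of_semireg_of_regular L α S hα hreal p w₀ hw₀' 1 hwall hpS
    (fun w : {w : InfinitePlace L // IsComplex w} => {cw : Fin 3 → ℝ |
        (w = w₀ → ∀ j : Fin 3, j ≠ 1 → Circle.exp (cw 1) ≠ Circle.exp (cw j)) ∧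
        (w ∉ S → w ≠ w₀ → Function.Injective fun l : Fin 3 => Circle.exp (cw l)) ∧ (w ∈ S → cw 0 ≠ 0)})
    (fun cw hcw => hcw.1 rfl) (fun w hw hws cw hcw => hcw.2.1 (fun hwS => hws ⟨hwS, hS w hwS⟩) hw) (fun w hws cw hcw => hcw.2.2 hws.1)
    _ hKS hKc C' hC'
  obtain ⟨C'', hC'', hsub⟩ := exists_isCompact_image_mk_superset
    (Subgroup.centralizer ({gprimeTorus L α S p} : Set ↥(arch (↥(maximalRealSubfield L)) L (IsCMField.complexConj L) 3 (Matrix.diagonal α)))) h𝒦'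
  refine ⟨C'', hC'', ?_⟩
  filter_upwards [Icc_mem_nhds (neg_lt_zero.2 hε) hε] with ν hν y' hy'
  obtain ⟨a, ha, hay⟩ := hsub (hmem𝒦 _ ⟨ν, hν, rfl⟩ y' hy')
  rw [QuotientGroup.eq] at hay
  exact ⟨a, ha, a⁻¹ * y', hay, by group⟩

/-! ## §2 Integrability off the wall -/

variable [MeasurableSpace ↥(arch (↥(maximalRealSubfield L)) L (IsCMField.complexConj L) 3 (Matrix.diagonal α))]
  [BorelSpace ↥(arch (↥(maximalRealSubfield L)) L (IsCMField.complexConj L) 3 (Matrix.diagonal α))]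
  (ν' : Measure ↥(arch (↥(maximalRealSubfield L)) L (IsCMField.complexConj L) 3 (Matrix.diagonal α))) [ν'.IsHaarMeasure] [ν'.IsMulRightInvariant]
  {a' : ↥(arch (↥(maximalRealSubfield L)) L (IsCMField.complexConj L) 3 (Matrix.diagonal α)) → ℂ}

/-- **`hintν` — THE CHART INTEGRAND ALONG THE NORMAL IS INTEGRABLE FOR SMALL `ν ≠ 0`**: the normal curve runs in `RegG S` off the wall (★ `eventually_add_smul_hcNrm_mem_regG`) and at
regular points of an admissible chart the integrand of `chartOrbG` is integrable for the chart quotient measure (★ `integrable_descConj_gprimeTorus_of_regG`).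
[cite: Rogawski1990, §8.2 p. 122; §4.3 p. 43] [cite: DeitmarEchterhoff2014, Lemma 9.3.3] [cite: HarishChandra1970, Part I §3 Lemma 22] -/
theorem eventually_integrable_descConj_add_smul_hcNrm (hα : ∀ i, α i ≠ 0) (hS : ∀ w, w ∈ S → w ∈ splitChartPlaces L α) (hw₀ : w₀ ∉ S) (hp : HcSemireg S w₀ 0 2 p)
    (ha'c : Continuous a') (ha's : HasCompactSupport a') :
    ∀ᶠ ν in 𝓝[≠] (0 : ℝ), Integrable (descConj (gprimeTorus L α S (p + ν • hcNrm w₀ 0 2)) (chartTorusG L α S) (forall_mem_chartTorusG_comm L α S _) a')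
      (chartQuotientMeasureG L α ν' S) := by
  letI : MeasurableSpace (↥(arch (↥(maximalRealSubfield L)) L (IsCMField.complexConj L) 3 (Matrix.diagonal α)) ⧸ chartTorusG L α S) := borel _
  haveI : BorelSpace (↥(arch (↥(maximalRealSubfield L)) L (IsCMField.complexConj L) 3 (Matrix.diagonal α)) ⧸ chartTorusG L α S) := ⟨rfl⟩
  haveI := isMulLeftInvariant_chartHaarG L α S
  haveI := isFiniteMeasureOnCompacts_chartHaarG L α S
  haveI := isOpenPosMeasure_chartHaarG L α S
  haveI := isInvInvariant_chartHaarG L α S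
  have hq : chartQuotientMeasureG L α ν' S = quotientMeasure (chartTorusG L α S) (chartHaarG L α S) (isClosed_chartTorusG L α S) ν' := rfl
  haveI : IsFiniteMeasureOnCompacts (chartQuotientMeasureG L α ν' S) := by rw [hq]; infer_instance
  filter_upwards [eventually_add_smul_hcNrm_mem_regG hw₀ (show (0 : Fin 3) ≠ 2 by decide) hp] with ν hν
  exact integrable_descConj_gprimeTorus_of_regG L α S hα hS hν ha'c ha's _

/-! ## §3 Both binders of ★ (J-G′-BLOCK), in its spelling -/

/-- **(J-G′-BLOCK-ν) — THE TWO EVENTUAL BINDERS OF ★ `exists_block_testFunction_chartOrbG_eventuallyEq` AT A SEMIREGULAR COMPACT-WALL POINT, hypothesis-free**: ONE compact `C″`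
with, for small `ν ≠ 0`, (`hCMν`) `y′ · gprimeTorus (p + ν • hcNrm w₀ 0 2) · y′⁻¹ ∈ tsupport a′ ⇒ y′ ∈ C″ · Z(gprimeTorus p)` and (`hintν`) integrability of the chart integrand at
`p + ν • hcNrm w₀ 0 2`.  The consumer picks one cut-off `β` for `C″` (or for `C″_S ∪ C″_{insert w₀ S}`) by ★ `exists_continuous_hasCompactSupport_integral_comp_mul_eq_one` and feeds ★ p850417
at `s := gprimeTorus L α S p`, `hT := chartTorusG_le_centralizer L α S p`. [cite: Rogawski1990, §4.12 Lemma 4.12.1 p. 66; §8.2 pp. 114, 122] [cite: HarishChandra1970, Part I §3 Lemma 22]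
[cite: Shelstad1979, §4 pp. 22–25] -/
theorem exists_blockNormal_binders (hα : ∀ i, α i ≠ 0)
    (hreal : ∀ (w : {w : InfinitePlace L // IsComplex w}) (i : Fin 3), (w.1.embedding (α i)).im = 0)
    (hS : ∀ w, w ∈ S → w ∈ splitChartPlaces L α) (hw₀ : w₀ ∉ S) (hp : HcSemireg S w₀ 0 2 p) (ha'c : Continuous a') (ha's : HasCompactSupport a') :
    ∃ C'' : Set ↥(arch (↥(maximalRealSubfield L)) L (IsCMField.complexConj L) 3 (Matrix.diagonal α)), IsCompact C'' ∧
      (∀ᶠ ν in 𝓝[≠] (0 : ℝ), ∀ y' : ↥(arch (↥(maximalRealSubfield L)) L (IsCMField.complexConj L) 3 (Matrix.diagonal α)),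
        y' * gprimeTorus L α S (p + ν • hcNrm w₀ 0 2) * y'⁻¹ ∈ tsupport a' →
          y' ∈ C'' * ((Subgroup.centralizer ({gprimeTorus L α S p} : Set ↥(arch (↥(maximalRealSubfield L)) L (IsCMField.complexConj L) 3 (Matrix.diagonal α)))) :
            Set ↥(arch (↥(maximalRealSubfield L)) L (IsCMField.complexConj L) 3 (Matrix.diagonal α)))) ∧
      (∀ᶠ ν in 𝓝[≠] (0 : ℝ), Integrable (descConj (gprimeTorus L α S (p + ν • hcNrm w₀ 0 2)) (chartTorusG L α S) (forall_mem_chartTorusG_comm L α S _) a')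
        (chartQuotientMeasureG L α ν' S)) := by
  obtain ⟨C'', hC'', hCM⟩ := exists_isCompact_mul_centralizer_nhds_hcSemireg L α S w₀ p hα hreal hS hw₀ hp ha's.isCompact
  exact ⟨C'', hC'', nhdsWithin_le_nhds hCM, eventually_integrable_descConj_add_smul_hcNrm L α S w₀ p ν' hα hS hw₀ hp ha'c ha's⟩

end Binders

end Literature.NumberTheory.Rogawski1990

end
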